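import Summits.BirchSwinnertonDyer.BirchSwinnertonDyer.Theorems.ManinLocalTwoThreeManinOddAtFourOfOrdJLeZero
import Summits.BirchSwinnertonDyer.BirchSwinnertonDyer.Theorems.ManinLocalTwoThreeManinOddAtFourOfSemistableTwist
import HarnessLib

/-!
# C2 `ManinOddAtFour` REDUCED BY NAME to its CORE: potentially supersingular curves (`ord₂ j > 0`) none of whose dyadic twists
# `W ⊗ ℚ(√d)`, `d ∈ {−1, 2, −2}`, is semistable at `2` (route `ManinLocalTwoThree`, crux C2 stmt-BirchSwinnertonDyer-22967; cell bsd-f2-manin, p2 gen 14)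

One-screen packaging of this seat's two by-name discharges (`maninOddAtFour_of_one_le_valuation_j`: `ord₂ j ≤ 0`;
`not_two_dvd_maninConstant_of_conductorExponent_quadraticTwist_le_one`: a `2`-semistable dyadic twist): the route decl `ManinOddAtFour` follows from
its restriction to the globally minimal `W` with `|j(W)|₂ < 1` AND `f₂(W ⊗ d) ≥ 2` for each `d ∈ {−1, 2, −2}` (`maninOddAtFour_of_core`).  In Kodaira
terms at `16 ∥ N` the core is the rows `II/4`, `I₀*/8`, `I₂*/10`, `I₃*/11` (`…_of_conductorExponent_eq_four_of_not_wildRow`); at `v₂(N) ∈ {2, 3}` it is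
everything (tame `IV`/`IV*`, wild `III`/`I₁*`/`III*`/`II*`); at `v₂(N) ≥ 5` it is the classes that are not `χ_{±8}`-twists of `2`-semistable ones.
HONEST FRAMING: a reduction, not a proof; modulo the crux's own printed-fact binders.  Nothing about BSD is proved; C2 OPEN on the core.
[cite: Stevens1989, Lemmas (5.2), (5.4)] [cite: Cesnavicius2018, Thm. 1.2] [cite: SilvermanAEC2009, X.5 Cor. 5.4.1]
-/

set_option autoImplicit false
-- lint-debt: the directory name repeats the summit name (sibling precedent `ManinLocalTwoThreeManinOddAtFourOfOrdJLeZero.lean`)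
set_option linter.dupNamespace false

noncomputable section

open scoped Classical NumberField
open WeierstrassCurve IsDedekindDomain IsDedekindDomain.HeightOneSpectrum Rat.HeightOneSpectrum
  Literature.NumberTheory.DiophantineGeometry Literature.NumberTheory.EllipticCurves
  Literature.NumberTheory.EllipticCurves.ModularForms

namespace Summit.BirchSwinnertonDyer.BirchSwinnertonDyer.Theorems.ManinLocalTwoThree

/-- **C2 from its core.**  If, granted the four printed facts, every lattice-optimal `X₀(N)`-datum (`4 ∣ N`) of every globally minimal `W` with
`|j(W)|₂ < 1` (potentially supersingular at `2`) and `f₂(W ⊗ d) ≥ 2` for `d = −1, 2, −2` (no dyadic twist semistable at `2`) has odd Manin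
constant, then `ManinOddAtFour` holds: the complement is covered by `maninOddAtFour_of_one_le_valuation_j` (`ord₂ j ≤ 0`) and
`not_two_dvd_maninConstant_of_conductorExponent_quadraticTwist_le_one` (a semistable dyadic twist).
[cite: Stevens1989, Lemmas (5.2), (5.4)] [cite: Cesnavicius2018, Thm. 1.2] -/
theorem maninOddAtFour_of_core
    (hcore : mazur_not_dvd_maninConstant_of_odd → abbesUllmo_not_dvd_maninConstant_of_not_dvd_level →
      cesnavicius_not_two_dvd_maninConstant_of_two_dvd_level → exists_isNewformOf →
      ∀ (W : WeierstrassCurve ℚ) [W.IsElliptic] [W.IsGloballyMinimal] {N : ℕ} [NeZero N] (D : ModularParametrizationData W N),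
        (∀ z ∈ D.L.lattice, ∃ w ∈ periodLattice D.f, z = D.c * w) → 2 ^ 2 ∣ N →
        ((primesEquiv (R := 𝓞 ℚ)).symm ⟨2, Nat.prime_two⟩).valuation ℚ W.j < 1 →
        (∀ d : ℤ, d = -1 ∨ d = 2 ∨ d = -2 →
          2 ≤ (W.quadraticTwist (d : ℚ)).conductorExponent ((primesEquiv (R := ℤ)).symm ⟨2, Nat.prime_two⟩)) →
        ¬ (2 : ℤ) ∣ D.maninConstant) :
    Summit.BirchSwinnertonDyer.BirchSwinnertonDyer.Theses.ManinLocalTwoThree.ManinOddAtFour := by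
  refine maninOddAtFour_of_pos_ordJ fun hM hAU hC2 hnf W _ _ N _ D hopt h4 hj ↦ ?_
  by_cases htw : ∀ d : ℤ, d = -1 ∨ d = 2 ∨ d = -2 →
      2 ≤ (W.quadraticTwist (d : ℚ)).conductorExponent ((primesEquiv (R := ℤ)).symm ⟨2, Nat.prime_two⟩)
  · exact hcore hM hAU hC2 hnf W D hopt h4 hj htw
  · push Not at htw
    obtain ⟨d, hd, hf⟩ := htw
    exact not_two_dvd_maninConstant_of_conductorExponent_quadraticTwist_le_one hM hAU hC2 hnf D hopt h4 hd (by omega)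

end Summit.BirchSwinnertonDyer.BirchSwinnertonDyer.Theorems.ManinLocalTwoThree

end
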